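/-
Origin: expansion seat `planner-pub-hodgecm-toy-0`, handover #2 2026-08-18T04:13:45Z (`HOME/pub-hodgecm-toy/lean/Toy/Model.lean`, md5 2043d57f, 205 lines);
landed by the gen-5 packager in gate run 21 as `HodgeCM/Model/Toy/Model.lean` (import ^import Toy\.→import HodgeCM.Model.Toy. ×1).
-/
-- HANDOVER (planner-pub-hodgecm-toy-0, unit pub-hodgecm-toy): WIP module `Toy.Model`; intended final module
-- `HodgeCM.Model.Toy.Model` (kind L5, toy model / consistency witness); rename `import Toy.X` ↦ the final prefix.
/-
Copyright: pub-hodgecm cell (HodgeCMPerL). Consistency-witness layer (part (e), referee A G4).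

# The toy universe `toyModelWith D`

The **exterior model**: `Coh X k = ⋀^k_ℚ (L X)`, pull-back = `exteriorPower.map`, cup = wedge, trace = 0,
algebraic classes := Hodge classes, `A_{(K,Φ)}` = the one-atom object of `(K,Φ)`, products = disjoint unions
of atom families, the Picard modular surface = the atom-free object of extra dimension 2.
The Hodge structures on the exterior powers enter through the typed interface `HodgeData` (naturality,
multiplicativity, and the prescribed weight-one filtration); `HodgeCM.Toy.ExteriorHodge` constructs the
canonical instance.
-/
import Mathlib
import Summits.HodgeConjecture.HodgeCM.Geometry.Facts
import Summits.HodgeConjecture.HodgeCM.Model.Toy.Objects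

namespace HodgeCM.Toy

open Literature.AlgebraicGeometry.Motives
open Literature.AlgebraicGeometry.Motives.HodgeStructure (EndAction conj ofRat)
open scoped TensorProduct
open exteriorPower

noncomputable section

/-! ### Presenting a CM field inside `ℂ` -/

namespace CMPresentation

variable (K : CMField)

/-- a chosen complex embedding -/
def σ₀ : K →ₐ[ℚ] ℂ := (Classical.arbitrary (K →+* ℂ)).toRatAlgHom

/-- `K` presented as a subfield of `ℂ` -/
def FK : IntermediateField ℚ ℂ := (σ₀ K).fieldRange

/-- the presentation isomorphism `K ≃ FK K` -/
def eK : K ≃ₐ[ℚ] FK K :=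
  (AlgEquiv.ofInjectiveField (σ₀ K)).trans
    (Subalgebra.equivOfEq _ _ (AlgHom.fieldRange_toSubalgebra (σ₀ K)).symm)

/-- (Ported verbatim from the HodgeCMPerL package; no docstring in the source.) -/
instance : FiniteDimensional ℚ (FK K) := Module.Finite.equiv (eK K).toLinearEquiv

/-- (Ported verbatim from the HodgeCMPerL package; no docstring in the source.) -/
instance : NumberField (FK K) := NumberField.mk

/-- (Ported verbatim from the HodgeCMPerL package; no docstring in the source.) -/
lemma finrank_FK : Module.finrank ℚ (FK K) = Module.finrank ℚ K := (eK K).toLinearEquiv.finrank_eq.symm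

/-- transporting an embedding of `K` to one of `FK K` -/
def embOf (σ : K →+* ℂ) : FK K →+* ℂ := σ.comp ((eK K).symm : FK K →+* K)

/-- (Ported verbatim from the HodgeCMPerL package; no docstring in the source.) -/
@[simp] lemma embOf_comp (σ : K →+* ℂ) : (embOf K σ).comp (eK K : K →+* FK K) = σ := by
  ext x; simp [embOf]

/-- (Ported verbatim from the HodgeCMPerL package; no docstring in the source.) -/
@[simp] lemma embOf_apply_eK (σ : K →+* ℂ) (x : K) : embOf K σ (eK K x) = σ x := by
  simp [embOf]

/-- (Ported verbatim from the HodgeCMPerL package; no docstring in the source.) -/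
lemma comp_eK_injective : Function.Injective (fun τ : FK K →+* ℂ => τ.comp (eK K : K →+* FK K)) := by
  intro τ τ' h
  ext y
  have := congrArg (fun ρ : K →+* ℂ => ρ ((eK K).symm y)) h
  simpa using this

/-- `Hom(FK K, ℂ) ≃ Hom(K, ℂ)` by composition with `eK`. -/
def embEquiv : (FK K →+* ℂ) ≃ (K →+* ℂ) where
  toFun τ := τ.comp (eK K : K →+* FK K)
  invFun := embOf K
  left_inv τ := by ext y; simp [embOf]
  right_inv σ := embOf_comp K σ

end CMPresentation

open CMPresentation

/-! ### The special objects -/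

/-- the atom of the CM type `(K, Φ)` -/
@[reducible] def atomOf (K : CMField) (Φ : CMType K) : Atom :=
  { F := FK K, Φ := {τ | τ.comp (eK K : K →+* FK K) ∈ Φ.1}
    cm := fun τ => Φ.2 (τ.comp (eK K : K →+* FK K)) }

/-- `A_{(K,Φ)}`: one atom -/
@[reducible] def cmObj (K : CMField) (Φ : CMType K) : Obj := ⟨.unit, fun _ => atomOf K Φ, 0⟩

/-- the Picard modular surface: no atom (so `H¹ = 0`), dimension `2` -/
@[reducible] def pmsObj : Obj := ⟨.empty, fun e => e.elim, 2⟩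

/-! ### The weight-one filtration and the Hodge-data interface -/

/-- The weight-one Hodge filtration on `ℂ ⊗ ⋀¹ L X` determined by `F¹ X`:
`F^p = ⊤ (p ≤ 0)`, `F¹ = F1 X` (transported along `⋀¹ L ≃ L`), `F^p = ⊥ (p ≥ 2)`. -/
def Obj.F1filt (X : Obj) (p : ℤ) : Submodule ℂ (ℂ ⊗[ℚ] ↥(⋀[ℚ]^1 X.L)) :=
  if p ≤ 0 then ⊤ else if p = 1 then X.F1.map ((oneEquiv ℚ X.L).symm.toLinearMap.baseChange ℂ) else ⊥

/-- **Hodge data** for the exterior model: a Hodge structure of weight `k` on every `⋀^k L X`, natural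
for Hodge maps, multiplicative for the wedge product in equal degrees, and equal to the CM filtration in
degree one. (`HodgeCM.Toy.ExteriorHodge.exteriorHodgeData` is the canonical instance.) -/
structure HodgeData where
  /-- the Hodge structure of weight `k` on `⋀^k L X` -/
  hs : ∀ (X : Obj) (k : ℕ), HodgeStructure (↥(⋀[ℚ]^k X.L)) (k : ℤ)
  /-- naturality: Hodge maps of lattices induce filtered maps on all exterior powers -/
  natural : ∀ {X Y : Obj} (f : Obj.Hom X Y) (k : ℕ) (p : ℤ),
    ((hs Y k).F p).map ((map k f.lin).baseChange ℂ) ≤ (hs X k).F p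
  /-- multiplicativity: `F^p ⋀^k ∧ F^q ⋀^k ⊆ F^{p+q} ⋀^{2k}` -/
  mul : ∀ (X : Obj) (k : ℕ) (p q : ℤ) (x y : ℂ ⊗[ℚ] ↥(⋀[ℚ]^k X.L)),
    x ∈ (hs X k).F p → y ∈ (hs X k).F q →
      LinearMap.BilinMap.baseChange ℂ (wedge ℚ X.L k k) x y ∈ (hs X (k + k)).F (p + q)
  /-- degree one is the CM filtration -/
  deg1 : ∀ (X : Obj) (p : ℤ), (hs X 1).F p = X.F1filt p

/-! ### The CM action on `H¹(A_{(K,Φ)})` -/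

section CMAction

variable (K : CMField) (Φ : CMType K)

/-- `K → L (A_{(K,Φ)}) = (Unit → FK K)` as an algebra map -/
def kToL : K →ₐ[ℚ] (cmObj K Φ).L := (Pi.constAlgHom ℚ Unit (FK K)).comp (eK K).toAlgHom

/-- (Ported verbatim from the HodgeCMPerL package; no docstring in the source.) -/
@[simp] lemma kToL_apply (e : K) (u : Unit) : kToL K Φ e u = eK K e := rfl

/-- multiplication by `e ∈ K` on the lattice -/
def mulK (e : K) : (cmObj K Φ).L →ₗ[ℚ] (cmObj K Φ).L := LinearMap.mulLeft ℚ (kToL K Φ e)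

/-- (Ported verbatim from the HodgeCMPerL package; no docstring in the source.) -/
lemma mulK_single (e : K) (y : FK K) :
    mulK K Φ e (Pi.single (M := fun _ : Unit => (FK K : Type)) () y) = Pi.single () (eK K e * y) := by
  funext u
  cases u
  simp [mulK, LinearMap.mulLeft_apply, Pi.mul_apply]

/-- (Ported verbatim from the HodgeCMPerL package; no docstring in the source.) -/
lemma mulK_comp_single (e : K) :
    mulK K Φ e ∘ₗ LinearMap.single ℚ (fun _ : Unit => (FK K : Type)) ()
      = LinearMap.single ℚ (fun _ : Unit => (FK K : Type)) () ∘ₗ LinearMap.mulLeft ℚ (eK K e) := by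
  refine LinearMap.ext fun y => ?_
  simp only [LinearMap.coe_comp, Function.comp_apply, LinearMap.coe_single, LinearMap.mulLeft_apply]
  exact mulK_single K Φ e y

/-- `e` acts on the eigenvector `eT τ` by `τ(e)`. -/
lemma mulK_baseChange_eT (e : K) (τ : FK K →+* ℂ) :
    (mulK K Φ e).baseChange ℂ ((cmObj K Φ).eT () τ) = τ (eK K e) • (cmObj K Φ).eT () τ := by
  change ((mulK K Φ e).baseChange ℂ ∘ₗ (LinearMap.single ℚ (fun _ : Unit => (FK K : Type)) ()).baseChange ℂ)
      (eps (FK K) τ) = _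
  rw [← LinearMap.baseChange_comp, mulK_comp_single, LinearMap.baseChange_comp, LinearMap.comp_apply,
    baseChange_mulLeft, tmul_mul_eps, map_smul]
  rfl

/-- (Ported verbatim from the HodgeCMPerL package; no docstring in the source.) -/
lemma isHodge_mulK (e : K) : Obj.IsHodge (mulK K Φ e) := by
  rw [Obj.isHodge_iff]
  rintro ⟨⟩ τ hτ
  rw [mulK_baseChange_eT]
  exact Submodule.smul_mem _ _ (Submodule.subset_span ⟨(), τ, hτ, rfl⟩)

/-- multiplication by `e` as an endomorphism of `A_{(K,Φ)}` -/
def mulHom (e : K) : Obj.Hom (cmObj K Φ) (cmObj K Φ) := ⟨mulK K Φ e, isHodge_mulK K Φ e⟩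

/-- the CM action on `⋀¹ L` as an algebra map -/
def cmι : K →ₐ[ℚ] Module.End ℚ ↥(⋀[ℚ]^1 (cmObj K Φ).L) :=
  (LinearEquiv.conjAlgEquiv ℚ (oneEquiv ℚ (cmObj K Φ).L).symm).toAlgHom.comp
    ((Algebra.lmul ℚ (cmObj K Φ).L).comp (kToL K Φ))

/-- (Ported verbatim from the HodgeCMPerL package; no docstring in the source.) -/
lemma cmι_apply (e : K) : cmι K Φ e = map 1 (mulK K Φ e) := by
  rw [map_one_eq]
  simp [cmι, LinearEquiv.conjAlgEquiv_apply, mulK]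
  rfl

variable (D : HodgeData)

/-- the `EndAction` of `K` on the weight-one Hodge structure of `A_{(K,Φ)}` -/
def cmAction : EndAction (D.hs (cmObj K Φ) 1) K where
  ι := cmι K Φ
  map_F_le e p := by
    rw [cmι_apply]
    exact D.natural (mulHom K Φ e) 1 p

end CMAction

/-! ### The universe -/

/-- **The toy universe** on the Hodge data `D` (reducible, so that its fields compute). -/
@[reducible] def toyModelWith (D : HodgeData) : Universe where
  Var := Obj
  dim X := Module.finrank ℚ X.L / 2 + X.extra
  Coh X k := ↥(⋀[ℚ]^k X.L)
  hodge := D.hs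
  alg X p := (D.hs X (2 * p)).hodgeClasses (p : ℤ)
  Mor := Obj.Hom
  idMor := Obj.Hom.id
  comp f g := f.comp g
  pull f k := map k f.lin
  cup X i j := wedge ℚ X.L i j
  tr _ _ := 0
  prod := Obj.prod
  fst := Obj.fst
  snd := Obj.snd
  IsAbelianVariety X := X.extra = 0
  IsCMAbelianVariety X := ∃ (K : CMField) (Φ : CMType K), X = cmObj K Φ
  cmAV := cmObj
  cmAct K Φ := cmAction K Φ D
  pms _ _ _ _ := pmsObj

end

end HodgeCM.Toy
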